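import Summits.KontsevichZagierPeriods.KontsevichZagierPeriods.Theorems.BetaCancellation.Negative.KernelForm
import Literature.NumberTheory.Transcendental.KZMellinFibres

/-!
# `BetaCancellation` (stmt-KontsevichZagierPeriods-13633) — load-bearing hypotheses, refuted strengthening

Companion of `Negative/KernelForm.lean` (kernel form `KernelCancellation`, `IsPinned`,
`betaKernel`, witnesses). cdisprove (refuter) lemmas, sorry-free, axioms ⊆ {propext,
Classical.choice, Quot.sound}:

* §1 LOAD-BEARING: `betaCancellation_false_without_pin'`, `_without_pin`, `_without_equiv` —
  the pinning of `q`, of `q'`, and the hypothesis `q ∼ q'` are each necessary (witness `a = b = 1`,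
  `r = [π]`, `r' = −[π]`, `q = [(0,1), 1] × (±[π])`).
* §2 REFUTED STRENGTHENING: `not_kernelCancellation_of_odd`, `not_kernelCancellation_two_mul_sub_one`,
  `not_polynomialKernelCancellation` — a NON-ZERO kernel of integral ZERO (`2t − 1`) does not
  cancel: `κ × r ∼ κ × (−r)` by ONE rule-(2) move (reflection of the kernel coordinate,
  `KZ.of_sub_of_mem_relations_of_boxReflection`) while `[π] ≁ −[π]`. Any proof of the crux must
  therefore use the non-vanishing of the Beta INTEGRAL, not merely of the kernel.
* §3 NOT LOAD-BEARING: `0 < a`, `0 < b` — `kernelCancellation_betaKernel_iff :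
  (∀ a b, KernelCancellation (betaKernel a b)) ↔ BetaCancellation`: for `|k| ∉ L¹(0,1)` a pinned `q`
  exists only over a.e.-null `r` (Tonelli), and those are relations; the Beta kernel with `a ≤ 0`
  or `b ≤ 0` is not integrable (comparison with `t⁻¹`).

References: Kontsevich–Zagier 2001 §1.2; this project's `KZCalculus.lean`.
-/

noncomputable section

set_option linter.dupNamespace false

namespace Summit.KontsevichZagierPeriods.KontsevichZagierPeriods.BetaCancellationNegative

open MeasureTheory Set
open Literature.NumberTheory.Transcendental
open Literature.NumberTheory.Transcendental.KZ
open Literature.ModelTheory.ExponentialFields (IsSemialgebraic isSemialgebraic_univ)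
open MvPolynomial (aeval X C)
open Summit.KontsevichZagierPeriods.KontsevichZagierPeriods.Theses.TerasomaMultiplication
  (BetaCancellation)
open Literature.NumberTheory.Transcendental.KZreg (unitIoo isSemialgebraic_unitIoo volume_unitIoo)

/-! ## §1 LOAD-BEARING HYPOTHESES

Each `…Without…` Prop is the crux with the named hypothesis dropped, in the crux's literal shape;
`_false_without_` shows any proof must use that hypothesis. Witness throughout: `a = b = 1`
(Beta kernel `≡ 1`), `r = [π] = [{x²+y² ≤ 1}, 1]`, `r' = −[π]`, and the pinned products
`[(0,1), 1] × (±[π])`. The positivity hypotheses `0 < a`, `0 < b` are NOT load-bearing — see §3. -/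

/-- The crux WITHOUT the two hypotheses pinning `q'` to `r'`. -/
def BetaCancellationWithoutPin' : Prop :=
  ∀ (a b : ℚ), 0 < a → 0 < b → ∀ ⦃n m : ℕ⦄ (r : IntegralRep n) (r' : IntegralRep m)
    (q : IntegralRep (1 + n)) (q' : IntegralRep (1 + m)),
    q.domain = {z | z (Fin.castAdd n 0) ∈ Set.Ioo (0:ℝ) 1 ∧ (fun j => z (Fin.natAdd 1 j)) ∈ r.domain} →
    Set.EqOn q.integrand (fun z => (z (Fin.castAdd n 0)) ^ ((a:ℝ) - 1) *
      (1 - z (Fin.castAdd n 0)) ^ ((b:ℝ) - 1) * r.integrand (fun j => z (Fin.natAdd 1 j))) q.domain →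
    Equivalent q q' → Equivalent r r'

/-- **The pinning of `q'` is load-bearing.** Witness: `q' := q` (pinned over `r = [π]`, not over
`r' = −[π]`). [folklore] -/
theorem betaCancellation_false_without_pin' : ¬ BetaCancellationWithoutPin' := by
  intro h
  have hq := isPinned_one_prod piRep
  exact not_equivalent_piRep_neg (h 1 1 one_pos one_pos piRep piRep.neg _
    ((polyKernelRep 1).prod piRep) hq.1 hq.2 (Equivalent.refl _))

/-- The crux WITHOUT the two hypotheses pinning `q` to `r`. -/
def BetaCancellationWithoutPin : Prop :=
  ∀ (a b : ℚ), 0 < a → 0 < b → ∀ ⦃n m : ℕ⦄ (r : IntegralRep n) (r' : IntegralRep m)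
    (q : IntegralRep (1 + n)) (q' : IntegralRep (1 + m)),
    q'.domain = {z | z (Fin.castAdd m 0) ∈ Set.Ioo (0:ℝ) 1 ∧ (fun j => z (Fin.natAdd 1 j)) ∈ r'.domain} →
    Set.EqOn q'.integrand (fun z => (z (Fin.castAdd m 0)) ^ ((a:ℝ) - 1) *
      (1 - z (Fin.castAdd m 0)) ^ ((b:ℝ) - 1) * r'.integrand (fun j => z (Fin.natAdd 1 j))) q'.domain →
    Equivalent q q' → Equivalent r r'

/-- **The pinning of `q` is load-bearing** (symmetric witness). [folklore] -/
theorem betaCancellation_false_without_pin : ¬ BetaCancellationWithoutPin := by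
  intro h
  have hq' := isPinned_one_prod piRep.neg
  exact not_equivalent_piRep_neg (h 1 1 one_pos one_pos piRep piRep.neg
    ((polyKernelRep 1).prod piRep.neg) _ hq'.1 hq'.2 (Equivalent.refl _))

/-- The crux WITHOUT the hypothesis `Equivalent q q'`. -/
def BetaCancellationWithoutEquiv : Prop :=
  ∀ (a b : ℚ), 0 < a → 0 < b → ∀ ⦃n m : ℕ⦄ (r : IntegralRep n) (r' : IntegralRep m)
    (q : IntegralRep (1 + n)) (q' : IntegralRep (1 + m)),
    q.domain = {z | z (Fin.castAdd n 0) ∈ Set.Ioo (0:ℝ) 1 ∧ (fun j => z (Fin.natAdd 1 j)) ∈ r.domain} →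
    Set.EqOn q.integrand (fun z => (z (Fin.castAdd n 0)) ^ ((a:ℝ) - 1) *
      (1 - z (Fin.castAdd n 0)) ^ ((b:ℝ) - 1) * r.integrand (fun j => z (Fin.natAdd 1 j))) q.domain →
    q'.domain = {z | z (Fin.castAdd m 0) ∈ Set.Ioo (0:ℝ) 1 ∧ (fun j => z (Fin.natAdd 1 j)) ∈ r'.domain} →
    Set.EqOn q'.integrand (fun z => (z (Fin.castAdd m 0)) ^ ((a:ℝ) - 1) *
      (1 - z (Fin.castAdd m 0)) ^ ((b:ℝ) - 1) * r'.integrand (fun j => z (Fin.natAdd 1 j))) q'.domain →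
    Equivalent r r'

/-- **`Equivalent q q'` is load-bearing** (the conclusion is not vacuous: non-equivalent pairs
with pinned products exist). [folklore] -/
theorem betaCancellation_false_without_equiv : ¬ BetaCancellationWithoutEquiv := by
  intro h
  have hq := isPinned_one_prod piRep
  have hq' := isPinned_one_prod piRep.neg
  exact not_equivalent_piRep_neg (h 1 1 one_pos one_pos piRep piRep.neg _ _ hq.1 hq.2 hq'.1 hq'.2)

/-! ## §2 REFUTED STRENGTHENING: cancellation needs `∫₀¹ k ≠ 0`, not just `k ≠ 0`

The natural strengthening "every non-zero (polynomial, `ℚ`-semialgebraic, integrable) kernel on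
`(0,1)` cancels" is FALSE: a kernel which is ODD about `t = 1/2` has `κ × r ∼ κ × (−r)` for every
`r` by ONE change of variables (reflect the kernel coordinate, rule 2), while `[π] ≁ −[π]`.
So any proof of the crux must use an input distinguishing `t^{a-1}(1-t)^{b-1}` from `2t − 1`,
i.e. (at least) the non-vanishing of the Beta INTEGRAL — a purely combinatorial manipulation of
move certificates that is blind to the kernel's value cannot prove `BetaCancellation`. -/

/-- Reflecting the kernel coordinate: the head of the reflected vector. [folklore] -/
theorem head_boxReflection {n : ℕ} (z : Fin (1 + n) → ℝ) :
    (fun i : Fin 1 => boxReflection (Fin.castAdd n 0) z (Fin.castAdd n i)) =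
      boxReflection 0 (fun i => z (Fin.castAdd n i)) := by
  funext i
  obtain rfl : i = 0 := Fin.fin_one_eq_zero i
  simp [boxReflection]

/-- Reflecting the kernel coordinate: the tail is unchanged. [folklore] -/
theorem tail_boxReflection {n : ℕ} (z : Fin (1 + n) → ℝ) (j : Fin n) :
    boxReflection (Fin.castAdd n 0) z (Fin.natAdd 1 j) = z (Fin.natAdd 1 j) := by
  have hne : Fin.natAdd 1 j ≠ Fin.castAdd n 0 := by
    intro h
    have := congrArg Fin.val h
    simp at this
  simp [boxReflection, hne]

/-- **Odd kernels anti-commute with negation modulo ONE move**: if `κ = [(0,1), k]` with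
`k (1 − t) = −k t`, then `κ × r ∼ κ × (−r)` for every `r` (rule 2 with the reflection of the kernel
coordinate, `|det| = 1`). [folklore] -/
theorem equivalent_prod_neg_of_odd {n : ℕ} (κ : IntegralRep 1) (hκ : κ.domain = unitIoo)
    (hodd : ∀ x ∈ unitIoo, κ.integrand (boxReflection 0 x) = -κ.integrand x) (r : IntegralRep n) :
    Equivalent (κ.prod r) (κ.prod r.neg) := by
  refine of_sub_of_mem_relations_of_boxReflection (Fin.castAdd n 0) ?_ ?_
  · ext z
    simp only [IntegralRep.prod_domain, IntegralRep.mem_prodDomain, IntegralRep.domain_neg,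
      mem_preimage, hκ, mem_unitIoo, tail_boxReflection]
    simp only [boxReflection, if_true, mem_Ioo]
    constructor <;> rintro ⟨⟨h1, h2⟩, h3⟩ <;> exact ⟨⟨by linarith, by linarith⟩, h3⟩
  · intro z hz
    simp only [IntegralRep.prod_domain, IntegralRep.mem_prodDomain, hκ, mem_unitIoo] at hz
    rw [IntegralRep.prod_integrand_eq, IntegralRep.prod_integrand_eq]
    simp only [IntegralRep.prodFun, IntegralRep.integrand_neg, Pi.neg_apply, tail_boxReflection]
    rw [head_boxReflection, hodd _ (by simpa using hz.1)]
    ring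

/-- **No cancellation by an odd kernel.** If `k` is odd about `1/2` on `(0,1)` and is the
integrand of some representation `κ = [(0,1), k]` (i.e. `k` is `ℚ`-semialgebraic and integrable
there, so that pinned products exist), then `KernelCancellation k` fails: witness `r = [π]`,
`r' = −[π]`, `q = κ × [π] ∼ q' = κ × (−[π])`. [folklore] -/
theorem not_kernelCancellation_of_odd {k : ℝ → ℝ} (κ : IntegralRep 1) (hκ : κ.domain = unitIoo)
    (hk : ∀ x ∈ unitIoo, κ.integrand x = k (x 0)) (hodd : ∀ t ∈ Ioo (0:ℝ) 1, k (1 - t) = -k t) :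
    ¬ KernelCancellation k := by
  intro h
  have hq := isPinned_prod κ hκ hk piRep
  have hq' := isPinned_prod κ hκ hk piRep.neg
  refine not_equivalent_piRep_neg (h piRep piRep.neg _ _ hq hq' ?_)
  refine equivalent_prod_neg_of_odd κ hκ (fun x hx => ?_) piRep
  have hx' : boxReflection 0 x ∈ unitIoo := by
    simp only [mem_unitIoo, boxReflection_apply_self, mem_Ioo] at hx ⊢
    constructor <;> linarith [hx.1, hx.2]
  rw [hk _ hx', hk _ hx, boxReflection_apply_self]
  exact hodd _ hx

/-- **The strengthening "every non-zero polynomial kernel cancels" is false**: the kernel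
`2t − 1` (non-zero, `ℚ`-polynomial, bounded) does not cancel. [folklore] -/
theorem not_kernelCancellation_two_mul_sub_one : ¬ KernelCancellation (fun t => 2 * t - 1) :=
  not_kernelCancellation_of_odd (polyKernelRep (2 * X 0 - 1)) rfl (fun x _ => by simp)
    (fun t _ => by ring)

/-- The same in the crux's literal shape: "cancellation by every `ℚ`-polynomial kernel that does
not vanish identically on `(0,1)`" — FALSE. -/
def PolynomialKernelCancellation : Prop :=
  ∀ p : Polynomial ℚ, (∃ t ∈ Set.Ioo (0:ℚ) 1, p.eval t ≠ 0) →
    ∀ ⦃n m : ℕ⦄ (r : IntegralRep n) (r' : IntegralRep m) (q : IntegralRep (1 + n))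
      (q' : IntegralRep (1 + m)),
    q.domain = {z | z (Fin.castAdd n 0) ∈ Set.Ioo (0:ℝ) 1 ∧ (fun j => z (Fin.natAdd 1 j)) ∈ r.domain} →
    Set.EqOn q.integrand (fun z => (p.map (algebraMap ℚ ℝ)).eval (z (Fin.castAdd n 0)) *
      r.integrand (fun j => z (Fin.natAdd 1 j))) q.domain →
    q'.domain = {z | z (Fin.castAdd m 0) ∈ Set.Ioo (0:ℝ) 1 ∧ (fun j => z (Fin.natAdd 1 j)) ∈ r'.domain} →
    Set.EqOn q'.integrand (fun z => (p.map (algebraMap ℚ ℝ)).eval (z (Fin.castAdd m 0)) *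
      r'.integrand (fun j => z (Fin.natAdd 1 j))) q'.domain →
    Equivalent q q' → Equivalent r r'

/-- `PolynomialKernelCancellation` is false (kernel `2t − 1`). [folklore] -/
theorem not_polynomialKernelCancellation : ¬ PolynomialKernelCancellation := by
  intro h
  have hp : ∃ t ∈ Set.Ioo (0:ℚ) 1, (2 * Polynomial.X - 1 : Polynomial ℚ).eval t ≠ 0 :=
    ⟨1/4, by norm_num, by norm_num⟩
  have hev : ∀ t : ℝ, ((2 * Polynomial.X - 1 : Polynomial ℚ).map (algebraMap ℚ ℝ)).eval t
      = 2 * t - 1 := by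
    intro t
    simp
  apply not_kernelCancellation_two_mul_sub_one
  intro n m r r' q q' hq hq' hqq'
  refine h _ hp r r' q q' hq.1 (fun z hz => ?_) hq'.1 (fun z hz => ?_) hqq'
  · rw [hq.2 hz]
    simp only [pinFun, hev]
  · rw [hq'.2 hz]
    simp only [pinFun, hev]

/-! ## §3 NOT LOAD-BEARING: `0 < a`, `0 < b` (non-integrable kernels cancel vacuously)

If `|k|` is NOT integrable on `(0,1)` then a representation `q` pinned over `r` with kernel `k`
exists only when `f = 0` a.e. on `σ` (Tonelli: integrability of `k ⊗ f` on `(0,1) × σ` forces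
`∫_σ |f| = 0` or `∫₀¹ |k| < ∞`), and then `[r] ∈ relations` (split `σ` into the semialgebraic zero
set of `f` and a null remainder). Hence `KernelCancellation k` HOLDS for such `k`
(`kernelCancellation_of_not_integrableOn`), in particular for the Beta kernel with `a ≤ 0` or
`b ≤ 0` (`kernelCancellation_betaKernel_of_nonpos_left/right`): the positivity hypotheses of the
crux only exclude degenerate-TRUE instances — they are non-vacuity guards that no proof can use. -/

/-- Transport of integrability between `S ⊆ ℝ` and `{x | x 0 ∈ S} ⊆ ℝ¹`. [folklore] -/
theorem integrableOn_comp_apply_zero_iff {g : ℝ → ℝ} {S : Set ℝ} :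
    IntegrableOn (fun x : Fin 1 → ℝ => g (x 0)) {x | x 0 ∈ S} ↔ IntegrableOn g S :=
  (volume_preserving_funUnique (Fin 1) ℝ).integrableOn_comp_preimage
    (MeasurableEquiv.funUnique (Fin 1) ℝ).measurableEmbedding

/-- A representation whose (semialgebraic) integrand vanishes a.e. on its domain is a relation:
domain additivity along the zero set `{x ∈ σ | f x = 0}` (semialgebraic by Tarski–Seidenberg,
`isSemialgebraic_sep_eq`) whose complement in `σ` is null. [folklore] -/
theorem of_mem_relations_of_ae_eq_zero {n : ℕ} (r : IntegralRep n)
    (h : ∀ᵐ x ∂(volume.restrict r.domain), r.integrand x = 0) : of r ∈ relations := by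
  have hE : IsSemialgebraic ℚ {x | x ∈ r.domain ∧ r.integrand x = (fun _ => (0:ℝ)) x} :=
    isSemialgebraic_sep_eq r.isSemialgebraicFunOn_integrand
      ((isSemialgebraicFunOn_aeval r.isSemialgebraic_domain 0).congr fun x _ => by simp)
  have hEr : {x | x ∈ r.domain ∧ r.integrand x = (fun _ => (0:ℝ)) x} ⊆ r.domain := fun x hx => hx.1
  have hvol : volume (r.domain \ {x | x ∈ r.domain ∧ r.integrand x = (fun _ => (0:ℝ)) x}) = 0 := by
    have h' := (ae_restrict_iff' (IntegralRep.measurableSet_domain_holds r)).1 h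
    rw [ae_iff] at h'
    refine measure_mono_null (fun x hx => ?_) h'
    simp only [mem_setOf_eq, Classical.not_imp]
    exact ⟨hx.1, fun h0 => hx.2 ⟨hx.1, h0⟩⟩
  have h1 := r.of_sub_of_restrict_mem_relations hE hEr hvol
  have h2 : of (r.restrict _ hE hEr) ∈ relations :=
    of_mem_relations_of_eqOn_zero _ fun x hx => hx.2
  have := relations.add_mem h1 h2
  simpa using this

/-- **Tonelli for pinned representations**: if `q` is pinned over `r` with kernel `k` and `f` is
not a.e. zero on `σ`, then `|k|` is integrable on `(0,1)`. [folklore] -/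
theorem integrableOn_abs_of_isPinned {n : ℕ} {k : ℝ → ℝ} {r : IntegralRep n}
    {q : IntegralRep (1 + n)} (hq : IsPinned k r q)
    (hr : ¬ ∀ᵐ x ∂(volume.restrict r.domain), r.integrand x = 0) :
    IntegrableOn (fun t => |k t|) (Ioo (0:ℝ) 1) := by
  obtain ⟨hd, hi⟩ := hq
  have hmeas : MeasurableSet q.domain := IntegralRep.measurableSet_domain_holds q
  have H0 : IntegrableOn (pinFun k r.integrand) (pinDomain r.domain) := by
    have := q.integrableOn.congr_fun hi hmeas
    rwa [hd] at this
  have H1 : IntegrableOn (fun p : (Fin 1 → ℝ) × (Fin n → ℝ) => k (p.1 0) * r.integrand p.2)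
      (unitIoo ×ˢ r.domain) ((volume : Measure (Fin 1 → ℝ)).prod volume) := by
    have h := ((volume_preserving_appendMeasurableEquiv (n := 1) (m := n)).integrableOn_comp_preimage
      (appendMeasurableEquiv 1 n).measurableEmbedding).2 H0
    have hpre : appendMeasurableEquiv 1 n ⁻¹' pinDomain r.domain = unitIoo ×ˢ r.domain := by
      ext p
      simp only [mem_preimage, appendMeasurableEquiv_apply, pinDomain, mem_setOf_eq,
        Fin.append_left, Fin.append_right, mem_prod, mem_unitIoo]
    have hfun : (pinFun k r.integrand ∘ appendMeasurableEquiv 1 n) =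
        fun p => k (p.1 0) * r.integrand p.2 := by
      funext p
      simp only [Function.comp_apply, appendMeasurableEquiv_apply, pinFun, Fin.append_left,
        Fin.append_right]
    rw [hpre, hfun, Measure.volume_eq_prod] at h
    exact h
  rw [IntegrableOn, ← Measure.prod_restrict] at H1
  have H2 := ((integrable_prod_iff H1.aestronglyMeasurable).1 H1).2
  have hC : ∀ x : Fin 1 → ℝ, ∫ y, ‖k (x 0) * r.integrand y‖ ∂(volume.restrict r.domain) =
      |k (x 0)| * ∫ y in r.domain, |r.integrand y| := by
    intro x
    simp only [norm_mul, Real.norm_eq_abs]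
    exact integral_const_mul _ _
  simp_rw [hC] at H2
  have hC0 : (∫ y in r.domain, |r.integrand y|) ≠ 0 := by
    intro h0
    apply hr
    have hint : IntegrableOn (fun y => |r.integrand y|) r.domain := r.integrableOn.abs
    have h1 := (integral_eq_zero_iff_of_nonneg_ae (ae_of_all _ fun y => abs_nonneg _) hint).1 h0
    filter_upwards [h1] with y hy
    simpa using hy
  have H3 : Integrable (fun x : Fin 1 → ℝ => |k (x 0)|) (volume.restrict unitIoo) := by
    refine (H2.mul_const (∫ y in r.domain, |r.integrand y|)⁻¹).congr (ae_of_all _ fun x => ?_)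
    simp only
    rw [mul_assoc, mul_inv_cancel₀ hC0, mul_one]
  exact integrableOn_comp_apply_zero_iff.1 H3

/-- **Non-integrable kernels pin only trivial representations**: if `|k| ∉ L¹(0,1)` and `q` is
pinned over `r` with kernel `k`, then `[r] ∈ relations`. [folklore] -/
theorem of_mem_relations_of_isPinned {n : ℕ} {k : ℝ → ℝ}
    (hk : ¬ IntegrableOn (fun t => |k t|) (Ioo (0:ℝ) 1)) {r : IntegralRep n}
    {q : IntegralRep (1 + n)} (hq : IsPinned k r q) : of r ∈ relations := by
  by_cases hr : ∀ᵐ x ∂(volume.restrict r.domain), r.integrand x = 0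
  · exact of_mem_relations_of_ae_eq_zero r hr
  · exact absurd (integrableOn_abs_of_isPinned hq hr) hk

/-- **Cancellation by a non-integrable kernel holds** (vacuously: both bases are relations).
[folklore] -/
theorem kernelCancellation_of_not_integrableOn {k : ℝ → ℝ}
    (hk : ¬ IntegrableOn (fun t => |k t|) (Ioo (0:ℝ) 1)) : KernelCancellation k :=
  fun _ _ _ _ _ _ hq hq' _ =>
    relations.sub_mem (of_mem_relations_of_isPinned hk hq) (of_mem_relations_of_isPinned hk hq')

/-- For `a ≤ 0` the Beta kernel is not integrable on `(0,1)`: on `(0, 1/2)` it dominates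
`m · t⁻¹`, `m = min 1 (1/2)^{b-1} > 0`, and `t⁻¹ ∉ L¹(0, 1/2)` (`intervalIntegrable_inv_iff`).
[folklore] -/
theorem not_integrableOn_abs_betaKernel_of_nonpos_left {a : ℚ} (ha : a ≤ 0) (b : ℚ) :
    ¬ IntegrableOn (fun t => |betaKernel a b t|) (Ioo (0:ℝ) 1) := by
  intro h
  set m : ℝ := min 1 ((1/2 : ℝ) ^ ((b:ℝ) - 1)) with hm
  have hm0 : 0 < m := lt_min one_pos (Real.rpow_pos_of_pos (by norm_num) _)
  have ha' : (a:ℝ) ≤ 0 := by exact_mod_cast ha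
  have hbound : ∀ t ∈ Ioo (0:ℝ) (1/2), t⁻¹ ≤ m⁻¹ * |betaKernel a b t| := by
    intro t ht
    have ht0 : 0 < t := ht.1
    have ht1 : t ≤ 1 := by linarith [ht.2]
    have h1 : t⁻¹ ≤ t ^ ((a:ℝ) - 1) := by
      rw [← Real.rpow_neg_one]
      exact Real.rpow_le_rpow_of_exponent_ge ht0 ht1 (by linarith)
    have h2 : m ≤ (1 - t) ^ ((b:ℝ) - 1) := by
      rcases le_or_gt 0 ((b:ℝ) - 1) with hb | hb
      · exact (min_le_right _ _).trans (Real.rpow_le_rpow (by norm_num) (by linarith [ht.2]) hb)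
      · refine (min_le_left _ _).trans ?_
        have h1t := Real.rpow_le_rpow_of_nonpos (x := 1 - t) (y := 1) (z := (b:ℝ) - 1)
          (by linarith [ht.2]) (by linarith) hb.le
        rwa [Real.one_rpow] at h1t
    have hpos : 0 ≤ t ^ ((a:ℝ) - 1) := Real.rpow_nonneg ht0.le _
    have hpos' : 0 ≤ (1 - t) ^ ((b:ℝ) - 1) := Real.rpow_nonneg (by linarith [ht.2]) _
    have hk : betaKernel a b t = t ^ ((a:ℝ) - 1) * (1 - t) ^ ((b:ℝ) - 1) := rfl
    rw [hk, abs_of_nonneg (mul_nonneg hpos hpos')]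
    have h3 : t⁻¹ * m ≤ t ^ ((a:ℝ) - 1) * (1 - t) ^ ((b:ℝ) - 1) := mul_le_mul h1 h2 hm0.le hpos
    calc t⁻¹ = m⁻¹ * (t⁻¹ * m) := by
          rw [mul_comm t⁻¹ m, ← mul_assoc, inv_mul_cancel₀ hm0.ne', one_mul]
      _ ≤ m⁻¹ * (t ^ ((a:ℝ) - 1) * (1 - t) ^ ((b:ℝ) - 1)) :=
          mul_le_mul_of_nonneg_left h3 (inv_nonneg.2 hm0.le)
  have hI : IntegrableOn (fun t : ℝ => t⁻¹) (Ioo (0:ℝ) (1/2)) := by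
    have h' : IntegrableOn (fun t => m⁻¹ * |betaKernel a b t|) (Ioo (0:ℝ) (1/2)) :=
      (h.mono_set (Ioo_subset_Ioo_right (by norm_num))).const_mul _
    refine h'.mono' measurable_inv.aestronglyMeasurable ?_
    refine ae_restrict_of_forall_mem measurableSet_Ioo fun t ht => ?_
    rw [Real.norm_eq_abs, abs_of_pos (inv_pos.2 ht.1)]
    exact hbound t ht
  have hII : IntervalIntegrable (fun t : ℝ => t⁻¹) volume 0 (1/2) := by
    rw [intervalIntegrable_iff_integrableOn_Ioo_of_le (by norm_num : (0:ℝ) ≤ 1/2)]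
    exact hI
  rcases intervalIntegrable_inv_iff.1 hII with h0 | h0
  · norm_num at h0
  · exact h0 Set.left_mem_uIcc

/-- The Beta kernel under `t ↦ 1 − t`: `k_{a,b}(1−t) = k_{b,a}(t)`. [folklore] -/
theorem betaKernel_one_sub (a b : ℚ) (t : ℝ) : betaKernel a b (1 - t) = betaKernel b a t := by
  simp only [betaKernel, sub_sub_cancel]
  ring

/-- For `b ≤ 0` the Beta kernel is not integrable on `(0,1)` (reflect `t ↦ 1 − t`, which
preserves Lebesgue measure and `(0,1)`). [folklore] -/
theorem not_integrableOn_abs_betaKernel_of_nonpos_right (a : ℚ) {b : ℚ} (hb : b ≤ 0) :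
    ¬ IntegrableOn (fun t => |betaKernel a b t|) (Ioo (0:ℝ) 1) := by
  intro h
  apply not_integrableOn_abs_betaKernel_of_nonpos_left hb a
  have hmp : MeasurePreserving (fun t : ℝ => 1 - t) volume volume :=
    Measure.measurePreserving_sub_left volume 1
  have hme : MeasurableEmbedding (fun t : ℝ => 1 - t) :=
    (MeasurableEquiv.subLeft (1:ℝ)).measurableEmbedding
  have hpre : (fun t : ℝ => 1 - t) ⁻¹' Ioo (0:ℝ) 1 = Ioo 0 1 := by
    ext t
    simp only [mem_preimage, mem_Ioo]
    constructor <;> rintro ⟨h1, h2⟩ <;> constructor <;> linarith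
  have h2 := (hmp.integrableOn_comp_preimage hme).2 h
  rw [hpre] at h2
  refine h2.congr_fun (fun t _ => ?_) measurableSet_Ioo
  simp only [Function.comp_apply, betaKernel_one_sub]

/-- **`BetaCancellation` with `a ≤ 0` HOLDS** (kernel form). [folklore] -/
theorem kernelCancellation_betaKernel_of_nonpos_left {a : ℚ} (ha : a ≤ 0) (b : ℚ) :
    KernelCancellation (betaKernel a b) :=
  kernelCancellation_of_not_integrableOn (not_integrableOn_abs_betaKernel_of_nonpos_left ha b)

/-- **`BetaCancellation` with `b ≤ 0` HOLDS** (kernel form). [folklore] -/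
theorem kernelCancellation_betaKernel_of_nonpos_right (a : ℚ) {b : ℚ} (hb : b ≤ 0) :
    KernelCancellation (betaKernel a b) :=
  kernelCancellation_of_not_integrableOn (not_integrableOn_abs_betaKernel_of_nonpos_right a hb)

/-- **The crux WITHOUT `0 < a`, `0 < b` is equivalent to the crux**: all parameter values
outside the positive quadrant are settled (true) by Tonelli. [folklore] -/
theorem kernelCancellation_betaKernel_iff :
    (∀ a b : ℚ, KernelCancellation (betaKernel a b)) ↔ BetaCancellation := by
  rw [betaCancellation_iff]
  refine ⟨fun h a b _ _ => h a b, fun h a b => ?_⟩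
  rcases le_or_gt a 0 with ha | ha
  · exact kernelCancellation_betaKernel_of_nonpos_left ha b
  rcases le_or_gt b 0 with hb | hb
  · exact kernelCancellation_betaKernel_of_nonpos_right a hb
  · exact h a b ha hb

end Summit.KontsevichZagierPeriods.KontsevichZagierPeriods.BetaCancellationNegative
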